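import Summits.CriticalPhenomena.SAWScalingLimit.Theorems.SAWDefectDecoherenceBoundaryClosureRZigzagDiscretisationPins
import Summits.CriticalPhenomena.SAWScalingLimit.Theorems.SAWDefectDecoherenceBoundaryClosureRCollarDomain
import HarnessLib

/-!
# Crux `BoundaryClosureR` (stmt-CriticalPhenomena-14004), line `polygon-parity-squeeze`,
# stub `stub_innerPolygonsOfZigzag` (7b): deep faces are kept; the sandwich

Landing target:
`Summits/CriticalPhenomena/SAWScalingLimit/Theorems/SAWDefectDecoherenceBoundaryClosureRZigzagDiscretisationDeep.lean`
(`--supports stmt-CriticalPhenomena-14004`; building block of the registered stub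
`stub_innerPolygonsOfZigzag`, the lattice half of the inner-polygon construction (IP)).

Two inclusions INTO the trimmed discretisation `Λ^P_δ = zdLam …`:

* `eventually_mem_zdLam_of_deep` — **K2: deep faces are kept**: for every `t > 0`, eventually every
  face whose scaled centre is at distance `≥ t` from `Pᶜ` is kept (it lies in `Λ δ` by exhaustion of
  the compact `{infDist · Pᶜ ≥ t}`; a `t`-ball inside `P` inside a chart sits at level `≥ t`
  (`≥ t/2` at a reflex corner, LEMMA U), which beats the float margin `(√3/6 + (√3/2)u)δ → 0`);
* `zdPass_of_mem_pinBall`, `eventually_collar_subset_zdLam` — **K4: the sandwich**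
  `collarDomain D (3ρ/4) (r₁/2) η δ (Λ δ) ⊆ Λ^P_δ`: `η`-deep faces of `Λ δ` are `η/2`-deep in `P`
  (as `{η/2 ≤ infDist · Ωᶜ} ⊆ P`), and inside the pinned half-discs every chart is the pinned line
  with the pin as threshold.

Sources: H. Duminil-Copin, S. Smirnov, Ann. of Math. 175 (2012) §2–§3; G. Lawler, O. Schramm,
W. Werner (2004) §3.4.  No proposition is defined and no named fact is introduced.
-/

noncomputable section

open scoped ComplexConjugate Topology
open Set Metric Filter
open Literature.Probability.LatticeModels Literature.Probability.RandomPlanarGeometry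
  Literature.Probability.RandomPlanarGeometry.SAW
open Summit.CriticalPhenomena.SAWScalingLimit.Theorems.PolygonParitySqueeze.InnerZigzag
  (level_split level_add_smul halfPlane_eq_of_level_eq_zero)

namespace Summit.CriticalPhenomena.SAWScalingLimit.Theorems.PolygonParitySqueeze.ZigzagDiscretisation

/-! ### 1. K2: deep faces are kept -/

/-- The float margin is small once `δ` and `δ·u` are: `δ(√3/6 + (√3/2)u) < t/2` if `δ ≤ t/4`,
`δ·u ≤ t/4`. [folklore] -/
theorem margin_lt {δ t : ℝ} {U : ℤ} (hδ : 0 < δ) (hδt : δ ≤ t / 4) (hU : δ * (U : ℝ) ≤ t / 4) (_hU0 : (0 : ℝ) ≤ U) :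
    δ * (Real.sqrt 3 / 6 + Real.sqrt 3 / 2 * U) < t / 2 := by
  have h32 : Real.sqrt 3 < 2 := by
    rw [show (2 : ℝ) = Real.sqrt 4 by rw [show (4 : ℝ) = 2 ^ 2 by norm_num, Real.sqrt_sq (by norm_num)]]
    exact Real.sqrt_lt_sqrt (by norm_num) (by norm_num)
  have h3p : 0 < Real.sqrt 3 := Real.sqrt_pos.2 (by norm_num)
  nlinarith

/-- **K2: deep faces are kept, eventually.** [folklore] -/
theorem eventually_mem_zdLam_of_deep {D : DobrushinDomain} {S : Set ℂ} {Cor : Finset ℂ} {κ : ℂ → Fin 6 × Fin 6 × Bool}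
    {r ρ r₁ r₀ : ℝ} {Λ : ℝ → Finset HexVertex} {m m₀ : ℝ → ℤ} {a b : ℝ → Sym2 HexVertex}
    (hA : AdmissibleFamily D ρ Λ m b) (hP : PinnedFlatRoot D Λ b (D.pt 0) a r₀ m₀)
    (hSo : IsOpen S) (hSD : S ⊆ D.carrier) (hr : 0 < r)
    (hCor : ∀ c ∈ Cor, c ∈ frontier S)
    (hsep : ∀ c ∈ Cor, ∀ c' ∈ Cor, c ≠ c' → 4 * r ≤ dist c c')
    (hflat : ∀ z ∈ frontier S, (∀ c ∈ Cor, r ≤ dist z c) → ∃ k : Fin 6, S ∩ ball z (r / 2) = halfPlane k z ∩ ball z (r / 2))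
    (Hκ : ∀ c ∈ Cor, ((κ c).2.2 = true ∧ S ∩ ball c (2 * r) = halfPlane (κ c).1 c ∩ halfPlane (κ c).2.1 c ∩ ball c (2 * r)) ∨
      ((κ c).2.2 = false ∧ S ∩ ball c (2 * r) = (halfPlane (κ c).1 c ∪ halfPlane (κ c).2.1 c) ∩ ball c (2 * r)))
    {t : ℝ} (ht : 0 < t) :
    ∀ᶠ δ : ℝ in 𝓝[>] 0, ∀ v : HexVertex, t ≤ infDist ((δ : ℂ) * hexCenter v) Sᶜ →
      v ∈ zdLam S Cor κ r (D.pt 1) (D.pt 0) ρ r₁ Λ m m₀ δ := by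
  set t' : ℝ := min t (r / 4) with ht'
  have ht'0 : 0 < t' := lt_min ht (by positivity)
  have ht't : t' ≤ t := min_le_left _ _
  have ht'r : t' ≤ r / 4 := min_le_right _ _
  have hfloat := eventually_delta_mul_float_le hA hP (show (0 : ℝ) < t' / 4 by positivity)
  obtain ⟨hρ, -, -, hexh, -⟩ := hA
  -- the compact `{t' ≤ infDist · Sᶜ}`
  set K : Set ℂ := {w : ℂ | t' ≤ infDist w Sᶜ} with hK
  have hKS : K ⊆ S := fun w hw => ball_subset_of_le_infDist hw (mem_ball_self ht'0)
  have hKc : IsCompact K :=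
    Metric.isCompact_of_isClosed_isBounded (isClosed_le continuous_const (continuous_infDist_pt _))
      ((D.isBounded.subset hSD).subset hKS)
  have hδ1 : ∀ᶠ δ : ℝ in 𝓝[>] 0, δ ∈ Ioo (0 : ℝ) (t' / 4) := Ioo_mem_nhdsGT (by positivity)
  filter_upwards [hexh K hKc (hKS.trans hSD), hfloat, hδ1] with δ hKδ hflδ hδδ v hv
  obtain ⟨hδ, hδt⟩ := hδδ
  set x₁ := D.pt 1
  set x₀ := D.pt 0
  set U : ℤ := |m δ - zdThr 0 x₁ δ| + |m₀ δ - zdThr 0 x₀ δ| + 2 with hU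
  have hU0 : (0 : ℝ) ≤ U := by
    have h1 := abs_nonneg (m δ - zdThr 0 x₁ δ)
    have h2 := abs_nonneg (m₀ δ - zdThr 0 x₀ δ)
    have : (0 : ℤ) ≤ U := by rw [hU]; linarith
    exact_mod_cast this
  have hmargin : δ * (Real.sqrt 3 / 6 + Real.sqrt 3 / 2 * U) < t' / 2 := margin_lt hδ hδt.le hflδ hU0
  set p : ℂ := (δ : ℂ) * hexCenter v with hp
  have hpt : t' ≤ infDist p Sᶜ := ht't.trans hv
  have hball : ball p t' ⊆ S := ball_subset_of_le_infDist hpt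
  have hFc : frontier S ⊆ Sᶜ := frontier_subset_compl hSo
  have hdistF : ∀ z ∈ frontier S, t' ≤ dist p z := fun z hz => hpt.trans (infDist_le_dist_of_mem (hFc hz))
  rw [mem_zdLam_iff, zdPass_iff]
  refine ⟨hKδ v hpt, hball (mem_ball_self ht'0), ?_, ?_⟩
  · -- flat tests
    intro z hz _ hpz k hk
    have hsub : ball p t' ⊆ halfPlane k z := by
      intro y hy
      have hyz : y ∈ ball z (r / 2) := by
        rw [mem_ball] at hy ⊢
        calc dist y z ≤ dist y p + dist p z := dist_triangle _ _ _
          _ < t' + r / 8 := by linarith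
          _ ≤ r / 2 := by linarith
      have : y ∈ S ∩ ball z (r / 2) := ⟨hball hy, hyz⟩
      rw [hk] at this
      exact this.1
    have hlev := level_ge_of_ball_subset k z p t' ht'0 hsub
    exact zdT_le_of_lt_level x₁ x₀ ρ r₁ (m δ) (m₀ δ) hδ k z v (by rw [← hp]; linarith)
  · -- corner tests
    intro c hc hpc
    have hcF := hCor c hc
    have hsubB : ball p t' ⊆ ball c (2 * r) := by
      intro y hy
      rw [mem_ball] at hy ⊢
      calc dist y c ≤ dist y p + dist p c := dist_triangle _ _ _
        _ < t' + 3 * r / 2 := by linarith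
        _ ≤ 2 * r := by linarith
    rcases Hκ c hc with ⟨hb, hch⟩ | ⟨hb, hch⟩
    · have hsub : ball p t' ⊆ halfPlane (κ c).1 c ∩ halfPlane (κ c).2.1 c := by
        intro y hy
        have : y ∈ S ∩ ball c (2 * r) := ⟨hball hy, hsubB hy⟩
        rw [hch] at this
        exact this.1
      rw [hb]
      refine ⟨fun _ => ⟨?_, ?_⟩, fun h => absurd h (by decide)⟩
      · have hlev := level_ge_of_ball_subset _ c p t' ht'0 (hsub.trans inter_subset_left)
        exact zdT_le_of_lt_level x₁ x₀ ρ r₁ (m δ) (m₀ δ) hδ _ c v (by rw [← hp]; linarith)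
      · have hlev := level_ge_of_ball_subset _ c p t' ht'0 (hsub.trans inter_subset_right)
        exact zdT_le_of_lt_level x₁ x₀ ρ r₁ (m δ) (m₀ δ) hδ _ c v (by rw [← hp]; linarith)
    · have hsub : ball p t' ⊆ halfPlane (κ c).1 c ∪ halfPlane (κ c).2.1 c := by
        intro y hy
        have : y ∈ S ∩ ball c (2 * r) := ⟨hball hy, hsubB hy⟩
        rw [hch] at this
        exact this.1
      rw [hb]
      refine ⟨fun h => absurd h (by decide), fun _ => ?_⟩
      have hno := corner_not_opposite hr hCor hsep hflat Hκ hc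
      rcases inner_innerNormal_cases (κ c).1 (κ c).2.1 with ⟨-, heq⟩ | hopp | ⟨hg, -⟩
      · -- degenerate reflex corner: one half-plane
        have hsub' : ball p t' ⊆ halfPlane (κ c).1 c := by rw [← heq, union_self] at hsub; exact hsub
        have hlev := level_ge_of_ball_subset _ c p t' ht'0 hsub'
        left
        exact zdT_le_of_lt_level x₁ x₀ ρ r₁ (m δ) (m₀ δ) hδ _ c v (by rw [← hp]; linarith)
      · exact absurd hopp hno
      · rcases level_ge_or_of_ball_subset_union _ _ c p ht'0 hg hsub with hlev | hlev
        · left; exact zdT_le_of_lt_level x₁ x₀ ρ r₁ (m δ) (m₀ δ) hδ _ c v (by rw [← hp]; linarith)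
        · right; exact zdT_le_of_lt_level x₁ x₀ ρ r₁ (m δ) (m₀ δ) hδ _ c v (by rw [← hp]; linarith)

/-! ### 2. K4: the sandwich -/

/-- **Faces of the pinned half-lattice inside the `3/4`-disc pass all tests** (one mesh): inside
`ball x (7R/8)` the carrier `S` is the open upper half-disc, so every chart met is the pinned line with
the pin `mr` as threshold. [folklore] -/
theorem zdPass_of_mem_pinBall {S : Set ℂ} {Cor : Finset ℂ} {κ : ℂ → Fin 6 × Fin 6 × Bool} {r R δ : ℝ} {x : ℂ}
    {T : Fin 6 → ℂ → ℤ} {mr : ℤ} (hr : 0 < r) (hrR : r ≤ R / 16)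
    (hSx : S ∩ ball x (7 * R / 8) = {z : ℂ | x.im < z.im} ∩ ball x (7 * R / 8))
    (hCor : ∀ c ∈ Cor, c ∈ frontier S)
    (Hκ : ∀ c ∈ Cor, ((κ c).2.2 = true ∧ S ∩ ball c (2 * r) = halfPlane (κ c).1 c ∩ halfPlane (κ c).2.1 c ∩ ball c (2 * r)) ∨
      ((κ c).2.2 = false ∧ S ∩ ball c (2 * r) = (halfPlane (κ c).1 c ∪ halfPlane (κ c).2.1 c) ∩ ball c (2 * r)))
    (hTzone : ∀ z : ℂ, z.im = x.im → dist z x < R → T 0 z = mr)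
    {v : HexVertex} (hrow : mr ≤ v.1 1) (hvx : (δ : ℂ) * hexCenter v ∈ ball x (3 * R / 4))
    (hup : x.im < ((δ : ℂ) * hexCenter v).im) : zdPass S Cor κ r T δ v = true := by
  set p : ℂ := (δ : ℂ) * hexCenter v with hp
  have hpx : dist p x < 3 * R / 4 := mem_ball.1 hvx
  have hSx' : S ∩ ball x (7 * R / 8) = halfPlane 0 x ∩ ball x (7 * R / 8) := by rw [halfPlane_zero]; exact hSx
  have hline : ∀ z ∈ frontier S, z ∈ ball x (7 * R / 8) → z.im = x.im := by
    intro z hz hzx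
    have := frontier_of_flat_chart hSx'
    have hmem : z ∈ frontier S ∩ ball x (7 * R / 8) := ⟨hz, hzx⟩
    rw [this] at hmem
    have h : ((z - x) * conj (innerNormal 0)).re = 0 := hmem.1
    have : ((z - x) * conj (innerNormal 0)).re = (z - x).im := by simp [innerNormal_eq]
    rw [this, Complex.sub_im] at h
    linarith
  -- every small ball about a point near `x` sees the pinned line as a chart of form `0`
  have hchart0 : ∀ (z : ℂ) (s : ℝ), z.im = x.im → s + dist z x ≤ 7 * R / 8 → S ∩ ball z s = halfPlane 0 z ∩ ball z s := by
    intro z s hzim hs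
    have hsub : ball z s ⊆ ball x (7 * R / 8) := ball_subset_ball' hs
    rw [inter_eq_inter_of_subset hSx' hsub, halfPlane_zero, halfPlane_zero, hzim]
  have hrow' : T 0 = T 0 := rfl
  rw [zdPass_iff]
  refine ⟨?_, ?_, ?_⟩
  · have : p ∈ {z : ℂ | x.im < z.im} ∩ ball x (7 * R / 8) := ⟨hup, mem_ball.2 (by linarith)⟩
    rw [← hSx] at this
    exact this.1
  · intro z hz _ hpz k hk
    have hzx : dist z x < 3 * R / 4 + r / 8 := by
      calc dist z x ≤ dist z p + dist p x := dist_triangle _ _ _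
        _ < r / 8 + 3 * R / 4 := by rw [dist_comm]; linarith
        _ = 3 * R / 4 + r / 8 := by ring
    have hzim := hline z hz (mem_ball.2 (by linarith))
    have h0 := hchart0 z (r / 2) hzim (by linarith)
    rw [hk] at h0
    have hk0 : k = 0 := eq_of_halfPlane_inter_ball_eq (by positivity) h0
    subst hk0
    rw [hTzone z hzim (by linarith)]
    exact hrow
  · intro c hc hpc
    have hcx : dist c x < 3 * R / 4 + 3 * r / 2 := by
      calc dist c x ≤ dist c p + dist p x := dist_triangle _ _ _
        _ < 3 * r / 2 + 3 * R / 4 := by rw [dist_comm]; linarith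
        _ = 3 * R / 4 + 3 * r / 2 := by ring
    have hcim := hline c (hCor c hc) (mem_ball.2 (by linarith))
    have h0 := hchart0 c (r / 2) hcim (by linarith)
    have hT0 : T 0 c = mr := hTzone c hcim (by linarith)
    have hsmall : ball c (r / 2) ⊆ ball c (2 * r) := ball_subset_ball (by linarith)
    rcases Hκ c hc with ⟨hb, hch⟩ | ⟨hb, hch⟩
    · have h1 := inter_eq_inter_of_subset hch hsmall
      rw [h0] at h1
      -- `halfPlane 0 c ∩ ball ⊆ halfPlane k c`, `⊆ halfPlane k' c`
      have hk : (κ c).1 = 0 := (eq_of_halfPlane_inter_ball_subset (by positivity : (0:ℝ) < r / 2)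
        (fun y hy => ((h1.subset hy).1).1)).symm
      have hk' : (κ c).2.1 = 0 := (eq_of_halfPlane_inter_ball_subset (by positivity : (0:ℝ) < r / 2)
        (fun y hy => ((h1.subset hy).1).2)).symm
      rw [hb, hk, hk', hT0]
      exact ⟨fun _ => ⟨hrow, hrow⟩, fun h => absurd h (by decide)⟩
    · have h1 := inter_eq_inter_of_subset hch hsmall
      rw [h0] at h1
      have hk : (κ c).1 = 0 := eq_of_halfPlane_inter_ball_subset (by positivity : (0:ℝ) < r / 2)
        (fun y hy => (h1.symm.subset ⟨Or.inl hy.1, hy.2⟩).1)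
      rw [hb, hk, hT0]
      exact ⟨fun h => absurd h (by decide), fun _ => Or.inl hrow⟩

/-- **K4: the sandwich `collarDomain D (3ρ/4) (r₁/2) η δ (Λ δ) ⊆ Λ^P_δ`, eventually.** [folklore] -/
theorem eventually_collar_subset_zdLam {D : DobrushinDomain} {S : Set ℂ} {Cor : Finset ℂ} {κ : ℂ → Fin 6 × Fin 6 × Bool}
    {r ρ r₁ r₀ η : ℝ} {Λ : ℝ → Finset HexVertex} {m m₀ : ℝ → ℤ} {a b : ℝ → Sym2 HexVertex}
    (hA : AdmissibleFamily D ρ Λ m b) (hP : PinnedFlatRoot D Λ b (D.pt 0) a r₀ m₀)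
    (hSo : IsOpen S) (hSD : S ⊆ D.carrier) (hr : 0 < r) (hrρ : r ≤ ρ / 16) (hrr₁ : r ≤ r₁ / 16) (hr₁r₀ : r₁ ≤ r₀)
    (hη : 0 < η) (hηS : {z : ℂ | z ∈ D.carrier ∧ η / 2 ≤ infDist z D.carrierᶜ} ⊆ S)
    (hS1 : S ∩ ball (D.pt 1) (7 * ρ / 8) = {z : ℂ | (D.pt 1).im < z.im} ∩ ball (D.pt 1) (7 * ρ / 8))
    (hS0 : S ∩ ball (D.pt 0) (7 * r₁ / 8) = {z : ℂ | (D.pt 0).im < z.im} ∩ ball (D.pt 0) (7 * r₁ / 8))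
    (hdist : ρ + r₁ ≤ dist (D.pt 0) (D.pt 1))
    (hCor : ∀ c ∈ Cor, c ∈ frontier S)
    (hsep : ∀ c ∈ Cor, ∀ c' ∈ Cor, c ≠ c' → 4 * r ≤ dist c c')
    (hflat : ∀ z ∈ frontier S, (∀ c ∈ Cor, r ≤ dist z c) → ∃ k : Fin 6, S ∩ ball z (r / 2) = halfPlane k z ∩ ball z (r / 2))
    (Hκ : ∀ c ∈ Cor, ((κ c).2.2 = true ∧ S ∩ ball c (2 * r) = halfPlane (κ c).1 c ∩ halfPlane (κ c).2.1 c ∩ ball c (2 * r)) ∨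
      ((κ c).2.2 = false ∧ S ∩ ball c (2 * r) = (halfPlane (κ c).1 c ∪ halfPlane (κ c).2.1 c) ∩ ball c (2 * r))) :
    ∀ᶠ δ : ℝ in 𝓝[>] 0, collarDomain D (3 * ρ / 4) (r₁ / 2) η δ (Λ δ) ⊆ zdLam S Cor κ r (D.pt 1) (D.pt 0) ρ r₁ Λ m m₀ δ := by
  have hK2 := eventually_mem_zdLam_of_deep (r₁ := r₁) hA hP hSo hSD hr hCor hsep hflat Hκ (half_pos hη)
  obtain ⟨hρ, hD1, hev, -, -⟩ := hA
  obtain ⟨hr₀, hD0, hev0, -⟩ := hP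
  have hr₁ : 0 < r₁ := by linarith
  have hSc : Sᶜ.Nonempty := by
    by_contra h
    rw [not_nonempty_iff_eq_empty, compl_empty_iff] at h
    exact D.toJordanDomain.carrier_ne_univ (univ_subset_iff.1 (h ▸ hSD))
  filter_upwards [hK2, hev, hev0] with δ hK2δ hevδ hev0δ v hv
  obtain ⟨-, -, -, hcar, hpin1⟩ := hevδ
  obtain ⟨-, -, hpin0⟩ := hev0δ
  rw [mem_collarDomain] at hv
  obtain ⟨hvΛ, hcase⟩ := hv
  set p : ℂ := (δ : ℂ) * hexCenter v with hp
  have hpD : p ∈ D.carrier := hcar v hvΛ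
  rcases hcase with hdeep | hroot | hgate
  · -- `η`-deep faces are `η/2`-deep in `S`
    apply hK2δ
    refine le_infDist_compl_of_ball_subset hSc fun y hy => hηS ⟨?_, ?_⟩
    · by_contra hyD
      have h0 : infDist y D.carrierᶜ = 0 := infDist_zero_of_mem hyD
      have := infDist_le_infDist_add_dist (x := p) (y := y) (s := D.carrierᶜ)
      rw [h0, zero_add] at this
      rw [mem_ball'] at hy
      linarith
    · have := infDist_le_infDist_add_dist (x := p) (y := y) (s := D.carrierᶜ)
      rw [mem_ball'] at hy
      linarith
  · -- root disc
    have hvx : p ∈ ball (D.pt 0) r₀ := ball_subset_ball (by linarith) hroot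
    have hrow : m₀ δ ≤ v.1 1 := (hpin0 v hvx).1 hvΛ
    have hup : (D.pt 0).im < p.im := by
      have : p ∈ D.carrier ∩ ball (D.pt 0) r₀ := ⟨hpD, hvx⟩
      rw [hD0] at this; exact this.1
    rw [mem_zdLam_iff]
    refine ⟨hvΛ, zdPass_of_mem_pinBall hr hrr₁ hS0 hCor Hκ
      (fun z hz hd => zdT_root _ _ ρ r₁ (m δ) (m₀ δ) δ hz hd hdist) hrow ?_ hup⟩
    exact ball_subset_ball (by linarith) hroot
  · -- gate disc
    have hvx : p ∈ ball (D.pt 1) ρ := ball_subset_ball (by linarith) hgate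
    have hrow : m δ ≤ v.1 1 := (hpin1 v hvx).1 hvΛ
    have hup : (D.pt 1).im < p.im := by
      have : p ∈ D.carrier ∩ ball (D.pt 1) ρ := ⟨hpD, hvx⟩
      rw [hD1] at this; exact this.1
    rw [mem_zdLam_iff]
    exact ⟨hvΛ, zdPass_of_mem_pinBall hr hrρ hS1 hCor Hκ
      (fun z hz hd => zdT_gate _ _ ρ r₁ (m δ) (m₀ δ) δ hz hd) hrow hgate hup⟩

/-- **The float margin is small** (registered form, sub-goal of `stub_innerPolygonsOfZigzag`). [folklore] -/
theorem zd_margin_lt : ∀ (δ t : ℝ) (U : ℤ), 0 < δ → δ ≤ t / 4 → δ * (U : ℝ) ≤ t / 4 → (0 : ℝ) ≤ U → δ * (Real.sqrt 3 / 6 + Real.sqrt 3 / 2 * U) < t / 2 :=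
  fun _ _ _ hδ hδt hU hU0 => margin_lt hδ hδt hU hU0

end Summit.CriticalPhenomena.SAWScalingLimit.Theorems.PolygonParitySqueeze.ZigzagDiscretisation

end
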